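import Summits.HodgeConjecture.HodgeConjecture.Theorems.BoundaryReadoutBoundarySupplyConstantFamily
import Literature.AlgebraicGeometry.HodgeTheory.ConjugationChartExistence
import Literature.AlgebraicGeometry.HodgeTheory.RationallyNormalisedDeRhamFamily
import Literature.AlgebraicGeometry.HodgeTheory.ComplexConjugationHolds
import Literature.AlgebraicGeometry.Motives.ComplexPointsManifold
import Literature.AlgebraicGeometry.Motives.BaseChangeProofs
import Literature.AlgebraicGeometry.Motives.VarietiesUnitProofs
import HarnessLib

/-!
# Boundary readout — the zero floor of the crux `BoundarySupply`

Route `BoundaryReadout` of the Hodge conjecture, crux #2 `BoundarySupply`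
(stmt-HodgeConjecture-15912): every rational `(p,p)`-class `c` on a smooth projective `X/ℂ` is
`e^*(ξ|_{X_t})` for a family `f : 𝒳 ⟶ C` over a smooth projective curve whose fibre over some `o` is
covered by finitely many smooth projective pieces `Y_i` on which the global rational `(p,p)`-class
`ξ` is ABSOLUTE HODGE (tree's de Rham `IsAbsoluteHodgeClass`: conjugates exist in some
`ConjugationChart` for every `σ ∈ Aut ℂ`, and every conjugate is a twisted rational `(p,p)`-class).

Up to now no instance of `IsAbsoluteHodgeClass` — hence none of the `∃`-block of the crux — was
available in the tree: a conjugation chart for `(σ, X, k)` asks for a smooth AFFINE `Y ⟶ X` with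
`(π^σ)^*` injective on `Hᵏ`, which for a projective `X` of positive dimension is Jouanolou's device
(named fact `jouanolou_cohomologyChart`, open in the tree). This file records what needs no device:

* `nonempty_conjugationChart_of_isAffine` — for a smooth AFFINE `Y/ℂ` the identity `𝟙_Y` is a
  conjugation chart for every `σ` and every degree, UNCONDITIONALLY: analytic models of `Y` and `Y^σ`
  exist (`nonempty_analyticModel_of_isAffine`, Serre GAGA §2, proved in the tree) and de Rham's theorem
  with rational periods is the tree's theorem `exists_isRational_complexDeRhamIsoFamily_holds`;
* `isAbsoluteHodgeClass_unit` — on the point `𝟙_ (SchemeOver ℂ) = Spec ℂ` (smooth projective of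
  dimension `0`, affine, `𝟙` smooth of relative dimension `0`) every class of positive even degree is
  absolute Hodge: `H²ᵖ(pt) = H²ᵖ(pt^σ) = 0` for `p ≥ 1`, and the conjugate `0 ↦ 0` exists in the
  identity chart — the first absolute Hodge class of the tree;
* `boundarySupply_zero` — the ZERO FLOOR of the crux: for every `ℂ`-scheme `X` and `p ≥ 1` the
  `∃`-block of `BoundarySupply` holds for `c = 0` (constant family of the point, `absoluteSupply` on
  `𝟙_`, and `e := toUnit X ≫ e₀`); `boundarySupply_of_lt` — outright in degrees `p > dim X`;
* `boundarySupply_iff_ne_zero` — so the crux is EQUIVALENT to its restriction to degree `p = 0` and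
  to NONZERO classes in the Hodge range `1 ≤ p ≤ dim X`: the degenerate witnesses are exactly the
  pull-backs from a point, and they are now kernel-checked rather than absent;
* `boundarySupplyBlock_of_map`, `boundarySupplyBlock_of_map_absolute` — supply is closed under
  pull-back, so `u^* c'` is supplied whenever `c'` is absolute on a smooth projective target; hence
  `boundarySupply_iff_absolutePullbacks` — granted ONLY the engine `BoundaryAbsoluteness`, the crux
  holds iff every Hodge class is a pull-back of an absolute Hodge class (Conj. 11.2.17 up to
  pull-back; no pull-back stability of absoluteness needed, unlike
  `boundarySupply_iff_hodgeClassesAbsolute`);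
* `nonempty_conjugationChart_of_injective`, `isAbsoluteHodgeClass_of_lt` — a chart needs from
  Jouanolou's device only the cohomological injectivity of one smooth affine probe; above the
  dimension (`p > dim X`, where `H²ᵖ(X^σ) = 0`) a complex point is such a probe, so every class there
  is absolute Hodge — with the point, all the absolute classes reachable without the device.

This corrects the item's record ("no degenerate witness … none constructible in tree", written
before `exists_isRational_complexDeRhamIsoFamily_holds` landed); it does not touch the content of the
crux (Charles–Schnell Conj. 11.2.17 for nonzero classes, `boundarySupply_iff_hodgeClassesAbsolute`).

References: [CharlesSchnell2014Notes] §11.2.2 (11.2.1)–(11.2.3), Def. 11.2.3, Conj. 11.2.17;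
[SerreGAGA1956] §2; [HatcherAT2002] Thm. 3.26; [Hartshorne1977] II.4 (`Spec k = ℙ⁰_k`), III.10.1.
-/

-- every declaration of this problem lives in `Summit.HodgeConjecture.HodgeConjecture.…` (summit = sub-problem)
set_option linter.dupNamespace false

noncomputable section

namespace Summit.HodgeConjecture.HodgeConjecture.Theorems

open CategoryTheory CategoryTheory.Limits AlgebraicGeometry MonoidalCategory CartesianMonoidalCategory
open Literature.AlgebraicTopology.SingularHomology
open Literature.AlgebraicGeometry.Motives Literature.AlgebraicGeometry.HodgeTheory
open Summit.HodgeConjecture.HodgeConjecture.Theses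

universe u

/-! ### Identity charts on smooth affine schemes; absolute classes on the point -/

section Charts

/-- **Identity conjugation charts.** For a smooth AFFINE `ℂ`-scheme `Y` (of relative dimension
`m`), every `σ ∈ Aut ℂ` and every degree `k`, the identity `𝟙_Y` is a conjugation chart for
`(σ, Y, k)`: `(𝟙_Y)^σ = 𝟙_{Y^σ}` is injective on `Hᵏ`, `Y` and `Y^σ` have analytic models charted on
`ℂᵐ` (Serre), and de Rham's theorem with rational periods supplies a natural rationally normalised
family on `ℂᵐ`-manifolds (tree theorem `exists_isRational_complexDeRhamIsoFamily_holds`). No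
Jouanolou device is needed in the affine case. [cite: CharlesSchnell2014Notes, §11.2.2 (11.2.1)–(11.2.3)]
[cite: SerreGAGA1956, §2] -/
theorem nonempty_conjugationChart_of_isAffine (σ : ℂ ≃+* ℂ) (m : ℕ) (Y : SchemeOver ℂ)
    [IsAffine Y.left] [SmoothOfRelativeDimension m Y.hom] (k : ℕ) :
    Nonempty (ConjugationChart σ Y k) := by
  obtain ⟨A⟩ := nonempty_analyticModel_of_isAffine m Y
  obtain ⟨A'⟩ := nonempty_analyticModel_of_isAffine m (conjugateVariety σ Y)
  obtain ⟨e, he, hr⟩ := exists_isRational_complexDeRhamIsoFamily_holds (Fin m → ℂ)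
  have hid : ∀ a : complexBetti (conjugateVariety σ Y) k, complexBetti.map (conjHom σ (𝟙 Y)) k a = a := by
    intro a
    have h1 : conjHom σ (𝟙 Y) = 𝟙 (conjugateVariety σ Y) := (baseChangeHom σ.toRingHom).map_id Y
    rw [h1, complexBetti.map_id]
    rfl
  exact
    ⟨{ m := m, Y := Y, π := 𝟙 Y, E := Fin m → ℂ, an := A, anConj := A', deRham := e
       deRham_isNatural := he, deRham_isRational := hr k
       injective_map := fun a b h => by rwa [hid, hid] at h }⟩

/-- The point `𝟙_ (SchemeOver ℂ) = Spec ℂ` is affine. [folklore] -/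
theorem isAffine_tensorUnit_left : IsAffine (𝟙_ (SchemeOver ℂ)).left :=
  inferInstanceAs (IsAffine (Spec _))

/-- The point `𝟙_ (SchemeOver ℂ) = Spec ℂ` is smooth of relative dimension `0` over `ℂ` (its
structural morphism is the identity). [folklore] -/
theorem smoothOfRelativeDimension_tensorUnit_hom :
    SmoothOfRelativeDimension 0 (𝟙_ (SchemeOver ℂ)).hom :=
  inferInstanceAs (SmoothOfRelativeDimension 0 (𝟙 _))

/-- **Classes of positive even degree on the point are absolute Hodge.** On `𝟙_ (SchemeOver ℂ)`
(smooth projective of dimension `0`) every `c ∈ H²ᵖ(pt(ℂ); ℂ)`, `p ≥ 1`, is an absolute Hodge class: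
`H²ᵖ(pt) = 0` and `H²ᵖ(pt^σ) = 0` (`pt^σ` is again smooth projective of dimension `0`), so `c = 0` is
rational of type `(p,p)`, its conjugate `0` exists in the identity chart, and every conjugate is
`0 = (2πi/σ(2πi))ᵖ • 0`. [cite: CharlesSchnell2014Notes, Def. 11.2.3] [cite: HatcherAT2002, Thm. 3.26] -/
theorem isAbsoluteHodgeClass_unit {p : ℕ} (hp : 1 ≤ p) (c : complexBetti (𝟙_ (SchemeOver ℂ)) (2 * p)) :
    IsAbsoluteHodgeClass 0 (𝟙_ (SchemeOver ℂ)) p c := by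
  have hU : IsSmoothProjective 0 (𝟙_ (SchemeOver ℂ)) := isSmoothProjective_unit_holds ℂ
  haveI := ComplexPoints.subsingleton_singularCohomology_of_lt hU ℂ (k := 2 * p) (by omega)
  obtain rfl : c = 0 := Subsingleton.elim _ _
  refine ⟨IsRationalClass.zero,
    isOfHodgeType_zero_of_isSmoothProjective nonempty_hodgeModel_holds hU _ _ _, fun σ => ⟨?_, ?_⟩⟩
  · haveI := isAffine_tensorUnit_left
    haveI := smoothOfRelativeDimension_tensorUnit_hom
    obtain ⟨D⟩ := nonempty_conjugationChart_of_isAffine σ 0 (𝟙_ (SchemeOver ℂ)) (2 * p)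
    exact ⟨0, isConjugateClass_zero D⟩
  · intro c' _
    have hUσ : IsSmoothProjective 0 (conjugateVariety σ (𝟙_ (SchemeOver ℂ))) :=
      IsSmoothProjective.conjugateVariety_holds σ hU
    haveI := ComplexPoints.subsingleton_singularCohomology_of_lt hUσ ℂ (k := 2 * p) (by omega)
    exact ⟨0, IsRationalClass.zero,
      isOfHodgeType_zero_of_isSmoothProjective nonempty_hodgeModel_holds hUσ _ _ _, Subsingleton.elim _ _⟩

end Charts

/-! ### The zero floor of `BoundarySupply` -/

section Floor

variable {n : ℕ} {X : SchemeOver ℂ}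

/-- **Supply is closed under pull-back.** If the `∃`-block of the crux `BoundarySupply` holds for
a class `c'` on a `ℂ`-scheme `X'`, then it holds for `u^* c'` on `X` for every `ℂ`-morphism
`u : X ⟶ X'`: keep the family, the covering and the global class, and replace `e₀ : X' ⟶ X_t` by
`u ≫ e₀`. So the crux need only be supplied on targets that are universal for pull-back (a point for
the zero class, below). [cite: CharlesSchnell2014Notes, §11.2.5] -/
theorem boundarySupplyBlock_of_map {X X' : SchemeOver ℂ} (u : X ⟶ X') {p : ℕ}
    (c' : complexBetti X' (2 * p))
    (h : ∃ (N : ℕ) (𝒳 C : SchemeOver ℂ) (f : 𝒳 ⟶ C) (o t : AlgPoints C ℂ) (ι : Type) (_ : Finite ι)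
      (m : ι → ℕ) (Y : ι → SchemeOver ℂ) (g : ∀ i, Y i ⟶ fiberOver f o)
      (ξ : complexBetti 𝒳 (2 * p)) (n' : ℕ) (e : X' ⟶ fiberOver f t),
      IsSmoothProjective N 𝒳 ∧ IsSmoothProjective 1 C ∧ Function.Surjective f.left.base ∧
      (∀ i, IsSmoothProjective (m i) (Y i)) ∧
      (∀ x : ↥(fiberOver f o).left, ∃ (i : ι) (y : ↥(Y i).left), (g i).left.base y = x) ∧
      IsRationalClass ξ ∧ IsOfHodgeType N 𝒳 (2 * p) p p ξ ∧
      (∀ i, IsAbsoluteHodgeClass (m i) (Y i) p (complexBetti.map (g i ≫ fiberι f o) (2 * p) ξ)) ∧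
      IsSmoothProjective n' (fiberOver f t) ∧
      complexBetti.map e (2 * p) (complexBetti.map (fiberι f t) (2 * p) ξ) = c') :
    ∃ (N : ℕ) (𝒳 C : SchemeOver ℂ) (f : 𝒳 ⟶ C) (o t : AlgPoints C ℂ) (ι : Type) (_ : Finite ι)
      (m : ι → ℕ) (Y : ι → SchemeOver ℂ) (g : ∀ i, Y i ⟶ fiberOver f o)
      (ξ : complexBetti 𝒳 (2 * p)) (n' : ℕ) (e : X ⟶ fiberOver f t),
      IsSmoothProjective N 𝒳 ∧ IsSmoothProjective 1 C ∧ Function.Surjective f.left.base ∧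
      (∀ i, IsSmoothProjective (m i) (Y i)) ∧
      (∀ x : ↥(fiberOver f o).left, ∃ (i : ι) (y : ↥(Y i).left), (g i).left.base y = x) ∧
      IsRationalClass ξ ∧ IsOfHodgeType N 𝒳 (2 * p) p p ξ ∧
      (∀ i, IsAbsoluteHodgeClass (m i) (Y i) p (complexBetti.map (g i ≫ fiberι f o) (2 * p) ξ)) ∧
      IsSmoothProjective n' (fiberOver f t) ∧
      complexBetti.map e (2 * p) (complexBetti.map (fiberι f t) (2 * p) ξ) =
        complexBetti.map u (2 * p) c' := by
  obtain ⟨N, 𝒳, C, f, o, t, ι, hι, m, Y, g, ξ, n', e₀, h𝒳, hC, hf, hY, hcov, hξ, hξ', habs, ht, he₀⟩ := h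
  refine ⟨N, 𝒳, C, f, o, t, ι, hι, m, Y, g, ξ, n', u ≫ e₀, h𝒳, hC, hf, hY, hcov, hξ, hξ', habs, ht, ?_⟩
  rw [complexBetti_map_comp_apply, he₀]

/-- **The zero floor.** For every `ℂ`-scheme `X` and `p ≥ 1`, the `∃`-block of the crux
`BoundarySupply` holds for the class `c = 0 ∈ H²ᵖ(X(ℂ); ℂ)`: the constant family of the POINT
(`absoluteSupply` for `𝟙_ (SchemeOver ℂ)` and its absolute class `0`, i.e. `pt × ℙ¹ ⟶ ℙ¹`, `o = t`,
one piece `Y = pt`, `ξ = 0`) pulled back along `toUnit X : X ⟶ pt` (`boundarySupplyBlock_of_map`):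
`e := toUnit X ≫ e₀` and `e^*(ξ|_{X_t}) = (toUnit X)^* 0 = 0`. [cite: CharlesSchnell2014Notes, Def. 11.2.3]
[cite: Hartshorne1977, II.4] -/
theorem boundarySupply_zero (X : SchemeOver ℂ) {p : ℕ} (hp : 1 ≤ p) :
    ∃ (N : ℕ) (𝒳 C : SchemeOver ℂ) (f : 𝒳 ⟶ C) (o t : AlgPoints C ℂ) (ι : Type) (_ : Finite ι)
      (m : ι → ℕ) (Y : ι → SchemeOver ℂ) (g : ∀ i, Y i ⟶ fiberOver f o)
      (ξ : complexBetti 𝒳 (2 * p)) (n' : ℕ) (e : X ⟶ fiberOver f t),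
      IsSmoothProjective N 𝒳 ∧ IsSmoothProjective 1 C ∧ Function.Surjective f.left.base ∧
      (∀ i, IsSmoothProjective (m i) (Y i)) ∧
      (∀ x : ↥(fiberOver f o).left, ∃ (i : ι) (y : ↥(Y i).left), (g i).left.base y = x) ∧
      IsRationalClass ξ ∧ IsOfHodgeType N 𝒳 (2 * p) p p ξ ∧
      (∀ i, IsAbsoluteHodgeClass (m i) (Y i) p (complexBetti.map (g i ≫ fiberι f o) (2 * p) ξ)) ∧
      IsSmoothProjective n' (fiberOver f t) ∧
      complexBetti.map e (2 * p) (complexBetti.map (fiberι f t) (2 * p) ξ) = 0 := by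
  have hU : IsSmoothProjective 0 (𝟙_ (SchemeOver ℂ)) := isSmoothProjective_unit_holds ℂ
  have h := boundarySupplyBlock_of_map (toUnit X) (0 : complexBetti (𝟙_ (SchemeOver ℂ)) (2 * p))
    (absoluteSupply hU p 0 (isAbsoluteHodgeClass_unit hp 0))
  rwa [map_zero] at h

/-- **The zero floor, pointed form**: the `∃`-block of `BoundarySupply` for any class `c = 0` of
positive degree. [cite: CharlesSchnell2014Notes, Def. 11.2.3] -/
theorem boundarySupply_of_eq_zero (X : SchemeOver ℂ) {p : ℕ} (hp : 1 ≤ p)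
    {c : complexBetti X (2 * p)} (hc : c = 0) :
    ∃ (N : ℕ) (𝒳 C : SchemeOver ℂ) (f : 𝒳 ⟶ C) (o t : AlgPoints C ℂ) (ι : Type) (_ : Finite ι)
      (m : ι → ℕ) (Y : ι → SchemeOver ℂ) (g : ∀ i, Y i ⟶ fiberOver f o)
      (ξ : complexBetti 𝒳 (2 * p)) (n' : ℕ) (e : X ⟶ fiberOver f t),
      IsSmoothProjective N 𝒳 ∧ IsSmoothProjective 1 C ∧ Function.Surjective f.left.base ∧
      (∀ i, IsSmoothProjective (m i) (Y i)) ∧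
      (∀ x : ↥(fiberOver f o).left, ∃ (i : ι) (y : ↥(Y i).left), (g i).left.base y = x) ∧
      IsRationalClass ξ ∧ IsOfHodgeType N 𝒳 (2 * p) p p ξ ∧
      (∀ i, IsAbsoluteHodgeClass (m i) (Y i) p (complexBetti.map (g i ≫ fiberι f o) (2 * p) ξ)) ∧
      IsSmoothProjective n' (fiberOver f t) ∧
      complexBetti.map e (2 * p) (complexBetti.map (fiberι f t) (2 * p) ξ) = c := by
  subst hc
  exact boundarySupply_zero X hp

/-- **Above the dimension the crux is free**: for `X` smooth projective of dimension `n` and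
`p > n`, `H²ᵖ(X(ℂ); ℂ) = 0` (Hatcher Thm. 3.26 on the closed `2n`-manifold `X(ℂ)`), so every class is
`0` and is supplied by the zero floor. [cite: HatcherAT2002, Thm. 3.26] -/
theorem boundarySupply_of_lt (hX : IsSmoothProjective n X) {p : ℕ} (hnp : n < p)
    (c : complexBetti X (2 * p)) :
    ∃ (N : ℕ) (𝒳 C : SchemeOver ℂ) (f : 𝒳 ⟶ C) (o t : AlgPoints C ℂ) (ι : Type) (_ : Finite ι)
      (m : ι → ℕ) (Y : ι → SchemeOver ℂ) (g : ∀ i, Y i ⟶ fiberOver f o)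
      (ξ : complexBetti 𝒳 (2 * p)) (n' : ℕ) (e : X ⟶ fiberOver f t),
      IsSmoothProjective N 𝒳 ∧ IsSmoothProjective 1 C ∧ Function.Surjective f.left.base ∧
      (∀ i, IsSmoothProjective (m i) (Y i)) ∧
      (∀ x : ↥(fiberOver f o).left, ∃ (i : ι) (y : ↥(Y i).left), (g i).left.base y = x) ∧
      IsRationalClass ξ ∧ IsOfHodgeType N 𝒳 (2 * p) p p ξ ∧
      (∀ i, IsAbsoluteHodgeClass (m i) (Y i) p (complexBetti.map (g i ≫ fiberι f o) (2 * p) ξ)) ∧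
      IsSmoothProjective n' (fiberOver f t) ∧
      complexBetti.map e (2 * p) (complexBetti.map (fiberι f t) (2 * p) ξ) = c := by
  haveI := ComplexPoints.subsingleton_singularCohomology_of_lt hX ℂ (k := 2 * p) (by omega)
  exact boundarySupply_of_eq_zero X (by omega) (Subsingleton.elim _ _)

/-- **Pinning the content of the crux to nonzero classes.** `BoundarySupply` is equivalent to its
restriction to the classes NOT on the zero floor: degree `p = 0`, or a NONZERO class in the Hodge
range `1 ≤ p ≤ dim X` (for `p > dim X` every class vanishes, `boundarySupply_of_lt`; for `c = 0`,
`boundarySupply_zero`). The degenerate witnesses of the `∃`-crux are exactly the pull-backs from a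
point; its content is the supply of nonzero Hodge classes (Charles–Schnell Conj. 11.2.17 inside the
route, `boundarySupply_iff_hodgeClassesAbsolute`). [cite: CharlesSchnell2014Notes, §11.2.5 Conj. 11.2.17] -/
theorem boundarySupply_iff_ne_zero :
    BoundaryReadout.BoundarySupply ↔
      ∀ ⦃n : ℕ⦄ ⦃X : SchemeOver ℂ⦄, IsSmoothProjective n X →
        ∀ (p : ℕ) (c : complexBetti X (2 * p)), IsRationalClass c → IsOfHodgeType n X (2 * p) p p c →
          (p = 0 ∨ (p ≤ n ∧ c ≠ 0)) →
          ∃ (N : ℕ) (𝒳 C : SchemeOver ℂ) (f : 𝒳 ⟶ C) (o t : AlgPoints C ℂ) (ι : Type) (_ : Finite ι)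
            (m : ι → ℕ) (Y : ι → SchemeOver ℂ) (g : ∀ i, Y i ⟶ fiberOver f o)
            (ξ : complexBetti 𝒳 (2 * p)) (n' : ℕ) (e : X ⟶ fiberOver f t),
            IsSmoothProjective N 𝒳 ∧ IsSmoothProjective 1 C ∧ Function.Surjective f.left.base ∧
            (∀ i, IsSmoothProjective (m i) (Y i)) ∧
            (∀ x : ↥(fiberOver f o).left, ∃ (i : ι) (y : ↥(Y i).left), (g i).left.base y = x) ∧
            IsRationalClass ξ ∧ IsOfHodgeType N 𝒳 (2 * p) p p ξ ∧
            (∀ i, IsAbsoluteHodgeClass (m i) (Y i) p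
              (complexBetti.map (g i ≫ fiberι f o) (2 * p) ξ)) ∧
            IsSmoothProjective n' (fiberOver f t) ∧
            complexBetti.map e (2 * p) (complexBetti.map (fiberι f t) (2 * p) ξ) = c := by
  refine ⟨fun hS n X hX p c hc hpp _ => hS hX p c hc hpp, fun h n X hX p c hc hpp => ?_⟩
  rcases Nat.eq_zero_or_pos p with hp | hp
  · exact h hX p c hc hpp (Or.inl hp)
  by_cases hc0 : c = 0
  · exact boundarySupply_of_eq_zero X hp hc0
  have hpn : p ≤ n := by
    by_contra hlt
    haveI := ComplexPoints.subsingleton_singularCohomology_of_lt hX ℂ (k := 2 * p) (by omega)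
    exact hc0 (Subsingleton.elim _ _)
  exact h hX p c hc hpp (Or.inr ⟨hpn, hc0⟩)

end Floor

/-! ### Absolute pull-back targets: the crux inside the route, without pull-back stability -/

section Targets

variable {n : ℕ} {X : SchemeOver ℂ}

/-- **Supply from an absolute pull-back target.** If `c'` is an absolute Hodge class on a smooth
projective `X'`, then `u^* c'` is supplied on `X` for every `ℂ`-morphism `u : X ⟶ X'`: the constant
family of `X'` (`absoluteSupply`) pulled back along `u` (`boundarySupplyBlock_of_map`). The zero
floor is the case `X' = pt`. [cite: CharlesSchnell2014Notes, Def. 11.2.3] [cite: Hartshorne1977, III Prop. 10.1] -/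
theorem boundarySupplyBlock_of_map_absolute {X X' : SchemeOver ℂ} (u : X ⟶ X') {n' p : ℕ}
    (hX' : IsSmoothProjective n' X') (c' : complexBetti X' (2 * p))
    (habs : IsAbsoluteHodgeClass n' X' p c') :
    ∃ (N : ℕ) (𝒳 C : SchemeOver ℂ) (f : 𝒳 ⟶ C) (o t : AlgPoints C ℂ) (ι : Type) (_ : Finite ι)
      (m : ι → ℕ) (Y : ι → SchemeOver ℂ) (g : ∀ i, Y i ⟶ fiberOver f o)
      (ξ : complexBetti 𝒳 (2 * p)) (n' : ℕ) (e : X ⟶ fiberOver f t),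
      IsSmoothProjective N 𝒳 ∧ IsSmoothProjective 1 C ∧ Function.Surjective f.left.base ∧
      (∀ i, IsSmoothProjective (m i) (Y i)) ∧
      (∀ x : ↥(fiberOver f o).left, ∃ (i : ι) (y : ↥(Y i).left), (g i).left.base y = x) ∧
      IsRationalClass ξ ∧ IsOfHodgeType N 𝒳 (2 * p) p p ξ ∧
      (∀ i, IsAbsoluteHodgeClass (m i) (Y i) p (complexBetti.map (g i ≫ fiberι f o) (2 * p) ξ)) ∧
      IsSmoothProjective n' (fiberOver f t) ∧
      complexBetti.map e (2 * p) (complexBetti.map (fiberι f t) (2 * p) ξ) =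
        complexBetti.map u (2 * p) c' :=
  boundarySupplyBlock_of_map u c' (absoluteSupply hX' p c' habs)

/-- **The crux from absolute pull-back targets** (unconditional direction): if every rational
`(p,p)`-class on a smooth projective `X` is the pull-back `u^* c'` of an ABSOLUTE Hodge class `c'` on
some smooth projective `X'` along some `u : X ⟶ X'`, then `BoundarySupply` holds. Weaker hypothesis
than Conj. 11.2.17 (`u = 𝟙`, `boundarySupply_of_hodgeClassesAbsolute`) as long as pull-backs of
absolute classes are not known to be absolute. [cite: CharlesSchnell2014Notes, §11.2.5 Conj. 11.2.17] -/
theorem boundarySupply_of_absolutePullbacks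
    (h : ∀ ⦃n : ℕ⦄ ⦃X : SchemeOver ℂ⦄, IsSmoothProjective n X →
      ∀ (p : ℕ) (c : complexBetti X (2 * p)), IsRationalClass c → IsOfHodgeType n X (2 * p) p p c →
        ∃ (n' : ℕ) (X' : SchemeOver ℂ) (u : X ⟶ X') (c' : complexBetti X' (2 * p)),
          IsSmoothProjective n' X' ∧ IsAbsoluteHodgeClass n' X' p c' ∧
            complexBetti.map u (2 * p) c' = c) :
    BoundaryReadout.BoundarySupply := by
  intro n X hX p c hc hpp
  obtain ⟨n', X', u, c', hX', habs, rfl⟩ := h hX p c hc hpp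
  exact boundarySupplyBlock_of_map_absolute u hX' c' habs

/-- **Absolute pull-back targets from the crux and the engine**: under `BoundaryAbsoluteness`
(crux #3 of the route), `BoundarySupply` makes every rational `(p,p)`-class a pull-back of an
absolute Hodge class on a smooth projective variety — namely `c = e^*(ξ|_{X_t})` with `ξ|_{X_t}`
absolute by the engine. [cite: CharlesSchnell2014Notes, §11.3 (Principle B) and Conj. 11.2.17] -/
theorem absolutePullbacks_of_boundarySupply (hS : BoundaryReadout.BoundarySupply)
    (hB : BoundaryReadout.BoundaryAbsoluteness) :
    ∀ ⦃n : ℕ⦄ ⦃X : SchemeOver ℂ⦄, IsSmoothProjective n X →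
      ∀ (p : ℕ) (c : complexBetti X (2 * p)), IsRationalClass c → IsOfHodgeType n X (2 * p) p p c →
        ∃ (n' : ℕ) (X' : SchemeOver ℂ) (u : X ⟶ X') (c' : complexBetti X' (2 * p)),
          IsSmoothProjective n' X' ∧ IsAbsoluteHodgeClass n' X' p c' ∧
            complexBetti.map u (2 * p) c' = c := by
  intro n X hX p c hc hpp
  obtain ⟨N, 𝒳, C, f, o, t, ι, hι, m, Y, g, ξ, n', e, h𝒳, hC, hf, hY, hcov, hξr, hξh, habs, ht, hc'⟩ :=
    hS hX p c hc hpp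
  haveI : Finite ι := hι
  exact ⟨n', fiberOver f t, e, _, ht,
    hB N p 𝒳 C f o h𝒳 hC hf ι m Y g hY hcov ξ hξr hξh habs t n' ht, hc'⟩

/-- **Inside the route the crux is "every Hodge class is a pull-back of an absolute Hodge class"**:
granted only the engine `BoundaryAbsoluteness`, `BoundarySupply` holds iff every rational
`(p,p)`-class on every smooth projective complex variety is `u^* c'` for an absolute Hodge class `c'`
on a smooth projective `X'` and a `ℂ`-morphism `u : X ⟶ X'`. This sharpens
`boundarySupply_iff_hodgeClassesAbsolute` (which also assumed pull-back stability of
absolute classes): the content of the crux is Conj. 11.2.17 up to pull-back. [cite: CharlesSchnell2014Notes, §11.2.5 Conj. 11.2.17] -/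
theorem boundarySupply_iff_absolutePullbacks (hB : BoundaryReadout.BoundaryAbsoluteness) :
    BoundaryReadout.BoundarySupply ↔
      ∀ ⦃n : ℕ⦄ ⦃X : SchemeOver ℂ⦄, IsSmoothProjective n X →
        ∀ (p : ℕ) (c : complexBetti X (2 * p)), IsRationalClass c → IsOfHodgeType n X (2 * p) p p c →
          ∃ (n' : ℕ) (X' : SchemeOver ℂ) (u : X ⟶ X') (c' : complexBetti X' (2 * p)),
            IsSmoothProjective n' X' ∧ IsAbsoluteHodgeClass n' X' p c' ∧
              complexBetti.map u (2 * p) c' = c :=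
  ⟨fun hS => absolutePullbacks_of_boundarySupply hS hB, boundarySupply_of_absolutePullbacks⟩

end Targets

/-! ### Above the dimension: absolute classes on positive-dimensional varieties -/

section AboveDimension

variable {n : ℕ} {X : SchemeOver ℂ}

/-- **Charts from one cohomologically injective affine probe.** A `ℂ`-morphism `π : Y ⟶ X` from a
smooth AFFINE `Y` with `π^σ` injective on `Hᵏ(–(ℂ); ℂ)` gives a conjugation chart for `(σ, X, k)`:
analytic models (Serre) and a natural rationally normalised de Rham family are unconditional; of
Jouanolou's device (`jouanolou_cohomologyChart`) only the injectivity is ever used.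
[cite: CharlesSchnell2014Notes, §11.2.2 (11.2.1)–(11.2.3)] [cite: SerreGAGA1956, §2] -/
theorem nonempty_conjugationChart_of_injective (σ : ℂ ≃+* ℂ) {m : ℕ} {Y X : SchemeOver ℂ}
    [IsAffine Y.left] [SmoothOfRelativeDimension m Y.hom] (π : Y ⟶ X) (k : ℕ)
    (hπ : Function.Injective (complexBetti.map (conjHom σ π) k)) :
    Nonempty (ConjugationChart σ X k) := by
  obtain ⟨A⟩ := nonempty_analyticModel_of_isAffine m Y
  obtain ⟨A'⟩ := nonempty_analyticModel_of_isAffine m (conjugateVariety σ Y)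
  obtain ⟨e, he, hr⟩ := exists_isRational_complexDeRhamIsoFamily_holds (Fin m → ℂ)
  exact
    ⟨{ m := m, Y := Y, π := π, E := Fin m → ℂ, an := A, anConj := A', deRham := e
       deRham_isNatural := he, deRham_isRational := hr k, injective_map := hπ }⟩

/-- `specOver ℂ ℂ → Spec ℂ` (`Spec` of the identity) is smooth of relative dimension `0`. [folklore] -/
theorem smoothOfRelativeDimension_specOver_hom : SmoothOfRelativeDimension 0 (specOver ℂ ℂ).hom := by
  haveI : IsIso (specOver ℂ ℂ).hom := by
    change IsIso (Spec.map (CommRingCat.ofHom (RingHom.id ℂ)))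
    rw [CommRingCat.ofHom_id]
    infer_instance
  infer_instance

/-- **Above the dimension every class is absolute Hodge.** For `X` smooth projective of dimension
`n` and `p > n`, every `c ∈ H²ᵖ(X(ℂ); ℂ)` is absolute Hodge: `H²ᵖ(X) = H²ᵖ(X^σ) = 0` (Hatcher 3.26;
`X^σ` is smooth projective of dimension `n`), so `c = 0`, and a complex point `Spec ℂ ⟶ X` is an affine
probe injective on `H²ᵖ(X^σ) = 0`. With `isAbsoluteHodgeClass_unit`: all the absolute classes reachable
without Jouanolou and Grothendieck. [cite: CharlesSchnell2014Notes, Def. 11.2.3] [cite: HatcherAT2002, Thm. 3.26] -/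
theorem isAbsoluteHodgeClass_of_lt (hX : IsSmoothProjective n X) {p : ℕ} (hnp : n < p)
    (c : complexBetti X (2 * p)) : IsAbsoluteHodgeClass n X p c := by
  haveI := ComplexPoints.subsingleton_singularCohomology_of_lt hX ℂ (k := 2 * p) (by omega)
  obtain rfl : c = 0 := Subsingleton.elim _ _
  refine ⟨IsRationalClass.zero,
    isOfHodgeType_zero_of_isSmoothProjective nonempty_hodgeModel_holds hX _ _ _, fun σ => ?_⟩
  have hXσ : IsSmoothProjective n (conjugateVariety σ X) := IsSmoothProjective.conjugateVariety_holds σ hX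
  haveI := ComplexPoints.subsingleton_singularCohomology_of_lt hXσ ℂ (k := 2 * p) (by omega)
  refine ⟨?_, fun c' _ => ⟨0, IsRationalClass.zero,
    isOfHodgeType_zero_of_isSmoothProjective nonempty_hodgeModel_holds hXσ _ _ _, Subsingleton.elim _ _⟩⟩
  haveI := connectedSpace_complexPoints hX
  obtain ⟨x₀⟩ : Nonempty (ComplexPoints X) := inferInstance
  haveI : IsAffine (specOver ℂ ℂ).left := inferInstanceAs (IsAffine (Spec _))
  haveI := smoothOfRelativeDimension_specOver_hom
  obtain ⟨D⟩ := nonempty_conjugationChart_of_injective σ (m := 0) (x₀ : specOver ℂ ℂ ⟶ X) (2 * p)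
    (fun a b _ => Subsingleton.elim a b)
  exact ⟨0, isConjugateClass_zero D⟩

end AboveDimension

end Summit.HodgeConjecture.HodgeConjecture.Theorems

end
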